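import Mathlib.MeasureTheory.Function.L2Space
import Mathlib.Analysis.SpecificLimits.Basic
import Literature.NumberTheory.Automorphic.SphericalNotSquareIntegrableRankOne
import HarnessLib

/-!
# Square-integrability modulo the centre from a square-summable shell profile of the matrix coefficients
# (Casselman 1995 Thm. 4.4.6 «⇐», analytic core; Harish-Chandra 1970 Part I §1)

Topic `NumberTheory/Automorphic`; namespace `Literature.NumberTheory.Automorphic.SphericalCoefficient` (the namespace of the converse
★ `summable_sq_mul_measureReal`, whose abstract-shell spelling is mirrored token for token).  THEOREMS ONLY; no definition, no named fact,
no instance, no notation, no `sorry`.  Cell `hodgecm-mathlib`, fan-B row #109 (`UnitaryGroup.U3SquareIntegrableExponents`,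
[Casselman1995, Thm. 4.4.6]) pay-down, N5 road brick R4 «⇐» (the analytic half of Casselman's criterion in rank one: exponents decay ⇒
square-integrable); generic in the group, unconditional.  HC_CM is proved only modulo the printed citations until rung 0 closes.

## What is formalised
Context as in ★ `SquareIntegrableCoefficientSummable` §1: `G` a group with a topology and separately continuous multiplication, `ρ` a complex
representation on `V`, `μ` any measure on `G ⧸ Z(G)` (★ `Representation.IsSquareIntegrableModCenter ρ μ` = every smooth matrix coefficient
`c_{φ,v}`, `φ ∈ Ṽ`, is dominated by the pull-back of an `L²(G ⧸ Z(G), μ)` function).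
* §1 **`isSquareIntegrableModCenter_of_shellDecay`** — the converse of ★ `summable_sq_mul_measureReal` (minus disjointness): if `S_n ⊆ G ⧸ Z(G)`
  (`n ∈ ℕ`) are measurable sets of finite measure COVERING `G ⧸ Z(G)` (not necessarily disjoint), and every smooth coefficient admits a shell profile
  `‖c_{φ,v}(g)‖ ≤ c_n` for `gZ ∈ S_n` with `Σ_n c_n² μ(S_n) < ∞`, then `ρ` is square-integrable modulo the centre: the dominating function
  is `f(x) = c_{h(x)}`, `h(x) = min {n | x ∈ S_n}` the height (`measurable_find_of_cover`; `memLp_two_comp_height`: `∫ f² dμ ≤ Σ_n c_n² μ(S_n)`).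
  **`…_geometric`** — the profile `c_n = C rⁿ` with `Σ_n r^{2n} μ(S_n) < ∞`; **`…_of_volume_le`** — `μ(S_n) ≤ C' Dⁿ`, `0 ≤ r`, `r² D < 1`
  (Casselman's «`|⟨ṽ, π(aⁿ) v⟩| ≤ C rⁿ`, `vol(K aⁿ K) ~ δ(a)⁻ⁿ`, `r² δ(a)⁻¹ < 1`»).
* §2 **`isSquareIntegrableModCenter_of_doubleCoset_decay`** — the same in the Cartan-shell vocabulary of ★ `SphericalNotSquareIntegrableRankOne`
  §3: `Z(G) ≤ K` compact open, `t ∈ G` with the double cosets `K tⁿ K` (`n ∈ ℕ`) covering `G` (no disjointness), `μ` finite on compacta,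
  profile `‖c_{φ,v}‖ ≤ c_n` on `K tⁿ K` with `Σ_n c_n² μ(KtⁿKZ/Z) < ∞` ⇒ square-integrable modulo the centre; and its geometric form.
The remaining (representation-theoretic) half of [Casselman1995, Thm. 4.4.6 «⇐»] — producing the profile `C rⁿ`, `r < 1`, on `K aⁿ K` from
the exponents via the Hecke ray operator `e_K π(a) e_K` and Jacquet's lemma — is the N5 road's bricks R1–R3 and is NOT done here.
-/

noncomputable section

open MeasureTheory Filter Topology
open scoped ENNReal

namespace Literature.NumberTheory.Automorphic.SphericalCoefficient

/-! ## §1 Abstract shells -/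

section Shells

variable {G V : Type*} [Group G] [TopologicalSpace G] [SeparatelyContinuousMul G]
  [AddCommGroup V] [Module ℂ V] [MeasurableSpace (G ⧸ Subgroup.center G)]
  {ρ : Representation ℂ G V} {μ : Measure (G ⧸ Subgroup.center G)}

omit [TopologicalSpace G] [SeparatelyContinuousMul G] in
/-- **The height of a countable measurable cover is measurable.**  For measurable `S_n ⊆ G ⧸ Z(G)` covering `G ⧸ Z(G)`, the height
`h(x) = min {n | x ∈ S_n}` has level sets `h⁻¹{n} = S_n ∩ ⋂_{m<n} S_mᶜ`, hence is measurable (no disjointness needed).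
[cite: HarishChandra1970, Part I §1 p. 4] -/
theorem measurable_find_of_cover {S : ℕ → Set (G ⧸ Subgroup.center G)} (hSm : ∀ n, MeasurableSet (S n))
    (hcov : ∀ x, ∃ n, x ∈ S n) [∀ x, DecidablePred fun n => x ∈ S n] :
    Measurable fun x => Nat.find (hcov x) := by
  refine measurable_to_countable' fun n => ?_
  have hpre : (fun x => Nat.find (hcov x)) ⁻¹' {n} = S n ∩ ⋂ m ∈ Finset.range n, (S m)ᶜ := by
    ext x
    simp only [Set.mem_preimage, Set.mem_singleton_iff, Nat.find_eq_iff, Set.mem_inter_iff, Set.mem_iInter,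
      Finset.mem_range, Set.mem_compl_iff]
  rw [hpre]
  exact (hSm n).inter (MeasurableSet.biInter (Set.to_countable _) fun m _ => (hSm m).compl)

omit [TopologicalSpace G] [SeparatelyContinuousMul G] in
/-- **The `L²` bound of a shell profile.**  For `S_n ⊆ G ⧸ Z(G)` of finite measure and a measurable height `h` with
`x ∈ S_{h(x)}` (so `h⁻¹{n} ⊆ S_n`; the `S_n` need NOT be disjoint), the function `x ↦ c_{h(x)}` satisfies
`∫⁻ ofReal(c_{h(x)}²) dμ = Σ_n ofReal(c_n²) μ(h⁻¹{n}) ≤ Σ_n ofReal(c_n² μ(S_n))`; in particular it is in `L²(μ)` as soon as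
`Σ_n c_n² μ(S_n) < ∞`. [cite: HarishChandra1970, Part I §1 p. 4] [cite: Casselman1995, §4.4 proof of Thm. 4.4.6] -/
theorem memLp_two_comp_height {S : ℕ → Set (G ⧸ Subgroup.center G)} (hSfin : ∀ n, μ (S n) < ⊤)
    {h : G ⧸ Subgroup.center G → ℕ} (hmeas : Measurable h) (hh : ∀ x, x ∈ S (h x))
    {c : ℕ → ℝ} (hsum : Summable (fun n => c n ^ 2 * μ.real (S n))) :
    MemLp (fun x => c (h x)) 2 μ := by
  have hae : AEStronglyMeasurable (fun x => c (h x)) μ := (measurable_from_nat.comp hmeas).aestronglyMeasurable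
  rw [memLp_two_iff_integrable_sq hae]
  refine ⟨(measurable_from_nat (f := fun n => c n ^ 2).comp hmeas).aestronglyMeasurable, ?_⟩
  rw [hasFiniteIntegral_iff_ofReal (Eventually.of_forall fun x => sq_nonneg _)]
  -- `∫⁻ ofReal (c_{h x}²) = Σ_n ofReal (c_n²) μ(h⁻¹{n}) ≤ Σ_n ofReal (c_n² μ(S_n)) = ofReal (Σ_n c_n² μ(S_n)) < ∞`
  have hmap : ∫⁻ x, ENNReal.ofReal (c (h x) ^ 2) ∂μ = ∫⁻ n, ENNReal.ofReal (c n ^ 2) ∂(μ.map h) :=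
    (lintegral_map (measurable_from_nat (f := fun n => ENNReal.ofReal (c n ^ 2))) hmeas).symm
  rw [hmap, lintegral_countable']
  have hterm : ∀ n, ENNReal.ofReal (c n ^ 2) * μ.map h {n} ≤ ENNReal.ofReal (c n ^ 2 * μ.real (S n)) := by
    intro n
    rw [Measure.map_apply hmeas (measurableSet_singleton n), ENNReal.ofReal_mul (sq_nonneg _), measureReal_def,
      ENNReal.ofReal_toReal (hSfin n).ne]
    exact mul_le_mul' le_rfl (measure_mono fun x (hx : h x = n) => hx ▸ hh x)
  refine lt_of_le_of_lt (ENNReal.tsum_le_tsum hterm) ?_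
  rw [← ENNReal.ofReal_tsum_of_nonneg (fun n => mul_nonneg (sq_nonneg _) measureReal_nonneg) hsum]
  exact ENNReal.ofReal_lt_top

/-- **Square-integrability modulo the centre from a square-summable shell profile** (the converse of ★ `summable_sq_mul_measureReal`,
WITHOUT its disjointness hypothesis; [Casselman1995, Thm. 4.4.6 «⇐»] analytic core).  If `S_n ⊆ G ⧸ Z(G)` (`n ∈ ℕ`) are measurable sets
of finite measure covering `G ⧸ Z(G)` (not necessarily disjoint) and every smooth matrix coefficient has a profile `‖c_{φ,v}(g)‖ ≤ c_n`
for `gZ ∈ S_n` with `Σ_n c_n² μ(S_n) < ∞`, then `ρ` is square-integrable modulo the centre w.r.t. `μ`: `‖c_{φ,v}(g)‖ ≤ f(gZ)` for the `L²`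
function `f(x) = c_{h(x)}`, `h` the height of the cover. [cite: Casselman1995, Thm. 4.4.6 and §2.5] [cite: HarishChandra1970, Part I §1 p. 4] -/
theorem isSquareIntegrableModCenter_of_shellDecay {S : ℕ → Set (G ⧸ Subgroup.center G)} (hSm : ∀ n, MeasurableSet (S n))
    (hSfin : ∀ n, μ (S n) < ⊤) (hcov : ∀ x, ∃ n, x ∈ S n)
    (hdecay : ∀ φ ∈ ρ.contragredient, ∀ v : V, ∃ c : ℕ → ℝ, Summable (fun n => c n ^ 2 * μ.real (S n)) ∧
      ∀ n (g : G), (g : G ⧸ Subgroup.center G) ∈ S n → ‖ρ.matrixCoeff φ v g‖ ≤ c n) :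
    ρ.IsSquareIntegrableModCenter μ := by
  classical
  intro φ hφ v
  obtain ⟨c, hsum, hc⟩ := hdecay φ hφ v
  exact ⟨fun x => c (Nat.find (hcov x)),
    memLp_two_comp_height hSfin (measurable_find_of_cover hSm hcov) (fun x => Nat.find_spec (hcov x)) hsum,
    fun g => hc _ g (Nat.find_spec (hcov (g : G ⧸ Subgroup.center G)))⟩

/-- **Geometric profile** ([Casselman1995, Thm. 4.4.6 «⇐»] as used: «`|⟨ṽ, π(g) v⟩| ≤ C rⁿ` on the `n`-th shell and `Σ_n r^{2n} vol(shell_n)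
< ∞`»): with a measurable finite-measure cover `S_n` of `G ⧸ Z(G)` as in `isSquareIntegrableModCenter_of_shellDecay`, if every smooth
coefficient satisfies `‖c_{φ,v}(g)‖ ≤ C rⁿ` for `gZ ∈ S_n` with `Σ_n r^{2n} μ(S_n) < ∞` (constants depending on `φ, v`), then `ρ` is
square-integrable modulo the centre. [cite: Casselman1995, Thm. 4.4.6 and §4.4] [cite: HarishChandra1970, Part I §1 p. 4] -/
theorem isSquareIntegrableModCenter_of_shellDecay_geometric {S : ℕ → Set (G ⧸ Subgroup.center G)} (hSm : ∀ n, MeasurableSet (S n))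
    (hSfin : ∀ n, μ (S n) < ⊤) (hcov : ∀ x, ∃ n, x ∈ S n)
    (hdecay : ∀ φ ∈ ρ.contragredient, ∀ v : V, ∃ C r : ℝ, Summable (fun n => r ^ (2 * n) * μ.real (S n)) ∧
      ∀ n (g : G), (g : G ⧸ Subgroup.center G) ∈ S n → ‖ρ.matrixCoeff φ v g‖ ≤ C * r ^ n) :
    ρ.IsSquareIntegrableModCenter μ := by
  refine isSquareIntegrableModCenter_of_shellDecay hSm hSfin hcov fun φ hφ v => ?_
  obtain ⟨C, r, hsum, hc⟩ := hdecay φ hφ v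
  refine ⟨fun n => C * r ^ n, ?_, hc⟩
  have heq : (fun n => (C * r ^ n) ^ 2 * μ.real (S n)) = fun n => C ^ 2 * (r ^ (2 * n) * μ.real (S n)) := by
    funext n
    rw [mul_pow, ← pow_mul, mul_comm n 2, mul_assoc]
  rw [heq]
  exact hsum.mul_left _

/-- **Volume-growth form** ([Casselman1995, §4.4]: «`vol(K aⁿ K) ≤ C' Dⁿ` and `r² D < 1`»): with a measurable finite-measure cover `S_n` of
`G ⧸ Z(G)` whose volumes grow at most geometrically, `μ(S_n) ≤ C' Dⁿ`, if every smooth coefficient satisfies `‖c_{φ,v}(g)‖ ≤ C rⁿ` for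
`gZ ∈ S_n` with `0 ≤ r` and `r² D < 1`, then `ρ` is square-integrable modulo the centre (`Σ r^{2n} μ(S_n) ≤ C' Σ (r²D)ⁿ < ∞`).
[cite: Casselman1995, Thm. 4.4.6 and §4.4] [cite: HarishChandra1970, Part I §1 p. 4] -/
theorem isSquareIntegrableModCenter_of_shellDecay_of_volume_le {S : ℕ → Set (G ⧸ Subgroup.center G)}
    (hSm : ∀ n, MeasurableSet (S n)) (hSfin : ∀ n, μ (S n) < ⊤) (hcov : ∀ x, ∃ n, x ∈ S n)
    {C' D : ℝ} (hD : 0 ≤ D) (hvol : ∀ n, μ.real (S n) ≤ C' * D ^ n)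
    (hdecay : ∀ φ ∈ ρ.contragredient, ∀ v : V, ∃ C r : ℝ, 0 ≤ r ∧ r ^ 2 * D < 1 ∧
      ∀ n (g : G), (g : G ⧸ Subgroup.center G) ∈ S n → ‖ρ.matrixCoeff φ v g‖ ≤ C * r ^ n) :
    ρ.IsSquareIntegrableModCenter μ := by
  refine isSquareIntegrableModCenter_of_shellDecay_geometric hSm hSfin hcov fun φ hφ v => ?_
  obtain ⟨C, r, hr, hrD, hc⟩ := hdecay φ hφ v
  refine ⟨C, r, ?_, hc⟩
  -- `0 ≤ r^{2n} μ(S_n) ≤ C' (r² D)ⁿ`, a convergent geometric series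
  have hC' : ∀ n, r ^ (2 * n) * μ.real (S n) ≤ C' * (r ^ 2 * D) ^ n := by
    intro n
    calc r ^ (2 * n) * μ.real (S n) ≤ r ^ (2 * n) * (C' * D ^ n) :=
          mul_le_mul_of_nonneg_left (hvol n) (pow_nonneg hr _)
      _ = C' * (r ^ 2 * D) ^ n := by rw [pow_mul, mul_pow]; ring
  refine Summable.of_nonneg_of_le (fun n => mul_nonneg (pow_nonneg hr _) measureReal_nonneg) hC' ?_
  exact (summable_geometric_of_lt_one (mul_nonneg (sq_nonneg r) hD) hrD).mul_left C'

end Shells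

/-! ## §2 Cartan shells `K tⁿ K` with `Z(G) ≤ K` -/

section DoubleCoset

variable {G V : Type*} [Group G] [TopologicalSpace G] [IsTopologicalGroup G]
  [AddCommGroup V] [Module ℂ V] [MeasurableSpace (G ⧸ Subgroup.center G)] [BorelSpace (G ⧸ Subgroup.center G)]
  {ρ : Representation ℂ G V} {K : Subgroup G}

/-- **Square-integrability modulo the centre from a square-summable profile on Cartan shells** ([Casselman1995, Thm. 4.4.6 «⇐»], the form
the rank-one criterion consumes): `Z(G) ≤ K` compact open, `t ∈ G` with the double cosets `K tⁿ K` (`n ∈ ℕ`) covering `G` (disjointness is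
NOT needed), `μ` finite on compacta; if every smooth coefficient satisfies `‖c_{φ,v}(g)‖ ≤ c_n` on `K tⁿ K` with `Σ_n c_n² μ(K tⁿ K Z ∕ Z) < ∞`, then `ρ`
is square-integrable modulo the centre w.r.t. `μ`.  Shell book-keeping: ★ `isOpen_image_doubleCoset`,
★ `isCompact_image_doubleCoset`, ★ `mem_doubleCoset_of_mk_mem_image`. [cite: Casselman1995, Thm. 4.4.6 and §4.4]
[cite: HarishChandra1970, Part I §1 p. 4] [cite: CartierCorvallis1979, §IV.1] -/
theorem isSquareIntegrableModCenter_of_doubleCoset_decay (hZK : Subgroup.center G ≤ K) (hKo : IsOpen (K : Set G))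
    (hKc : IsCompact (K : Set G)) {t : G} (hcov : ∀ g : G, ∃ n : ℕ, g ∈ DoubleCoset.doubleCoset (t ^ n) (K : Set G) K)
    (μ : Measure (G ⧸ Subgroup.center G)) [IsFiniteMeasureOnCompacts μ]
    (hdecay : ∀ φ ∈ ρ.contragredient, ∀ v : V, ∃ c : ℕ → ℝ,
      Summable (fun n => c n ^ 2 *
        μ.real ((QuotientGroup.mk : G → G ⧸ Subgroup.center G) '' DoubleCoset.doubleCoset (t ^ n) (K : Set G) K)) ∧
      ∀ n, ∀ g ∈ DoubleCoset.doubleCoset (t ^ n) (K : Set G) K, ‖ρ.matrixCoeff φ v g‖ ≤ c n) :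
    ρ.IsSquareIntegrableModCenter μ := by
  have hSm : ∀ n, MeasurableSet ((QuotientGroup.mk : G → G ⧸ Subgroup.center G) '' DoubleCoset.doubleCoset (t ^ n) (K : Set G) K) :=
    fun n => (isOpen_image_doubleCoset hKo _).measurableSet
  have hSfin : ∀ n, μ ((QuotientGroup.mk : G → G ⧸ Subgroup.center G) '' DoubleCoset.doubleCoset (t ^ n) (K : Set G) K) < ⊤ :=
    fun n => (isCompact_image_doubleCoset hKc _).measure_lt_top
  have hcov' : ∀ x : G ⧸ Subgroup.center G, ∃ n : ℕ,
      x ∈ (QuotientGroup.mk : G → G ⧸ Subgroup.center G) '' DoubleCoset.doubleCoset (t ^ n) (K : Set G) K := by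
    intro x
    induction x using QuotientGroup.induction_on with
    | H g => exact (hcov g).imp fun n hg => Set.mem_image_of_mem _ hg
  refine isSquareIntegrableModCenter_of_shellDecay hSm hSfin hcov' fun φ hφ v => ?_
  obtain ⟨c, hsum, hc⟩ := hdecay φ hφ v
  exact ⟨c, hsum, fun n g hg => hc n g (mem_doubleCoset_of_mk_mem_image hZK hg)⟩

/-- **Geometric profile on Cartan shells** ([Casselman1995, Thm. 4.4.6 «⇐»] verbatim shape): under the hypotheses of
`isSquareIntegrableModCenter_of_doubleCoset_decay`, if every smooth coefficient satisfies `‖c_{φ,v}(g)‖ ≤ C rⁿ` on `K tⁿ K` with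
`Σ_n r^{2n} μ(K tⁿ K Z ∕ Z) < ∞`, then `ρ` is square-integrable modulo the centre. [cite: Casselman1995, Thm. 4.4.6 and §4.4]
[cite: HarishChandra1970, Part I §1 p. 4] [cite: CartierCorvallis1979, §IV.1] -/
theorem isSquareIntegrableModCenter_of_doubleCoset_decay_geometric (hZK : Subgroup.center G ≤ K) (hKo : IsOpen (K : Set G))
    (hKc : IsCompact (K : Set G)) {t : G} (hcov : ∀ g : G, ∃ n : ℕ, g ∈ DoubleCoset.doubleCoset (t ^ n) (K : Set G) K)
    (μ : Measure (G ⧸ Subgroup.center G)) [IsFiniteMeasureOnCompacts μ]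
    (hdecay : ∀ φ ∈ ρ.contragredient, ∀ v : V, ∃ C r : ℝ,
      Summable (fun n => r ^ (2 * n) *
        μ.real ((QuotientGroup.mk : G → G ⧸ Subgroup.center G) '' DoubleCoset.doubleCoset (t ^ n) (K : Set G) K)) ∧
      ∀ n, ∀ g ∈ DoubleCoset.doubleCoset (t ^ n) (K : Set G) K, ‖ρ.matrixCoeff φ v g‖ ≤ C * r ^ n) :
    ρ.IsSquareIntegrableModCenter μ := by
  refine isSquareIntegrableModCenter_of_doubleCoset_decay hZK hKo hKc hcov μ fun φ hφ v => ?_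
  obtain ⟨C, r, hsum, hc⟩ := hdecay φ hφ v
  refine ⟨fun n => C * r ^ n, ?_, hc⟩
  have heq : (fun n => (C * r ^ n) ^ 2 *
      μ.real ((QuotientGroup.mk : G → G ⧸ Subgroup.center G) '' DoubleCoset.doubleCoset (t ^ n) (K : Set G) K)) =
      fun n => C ^ 2 * (r ^ (2 * n) *
        μ.real ((QuotientGroup.mk : G → G ⧸ Subgroup.center G) '' DoubleCoset.doubleCoset (t ^ n) (K : Set G) K)) := by
    funext n
    rw [mul_pow, ← pow_mul, mul_comm n 2, mul_assoc]
  rw [heq]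
  exact hsum.mul_left _

end DoubleCoset

end Literature.NumberTheory.Automorphic.SphericalCoefficient

end
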